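import Literature.AlgebraicTopology.CharacteristicClasses.FramedBundleTrivial
import HarnessLib

/-!
# Framed bundles: the trivialising isomorphism `(x, c) ↦ Σ cᵢ σᵢ(x)` and isomorphisms matching two frames

J. Milnor, J. Stasheff, *Characteristic Classes* (1974), §2, Thm. 2.2 and Lemma 2.3: a vector
bundle with `n` nowhere dependent cross-sections `s₁, …, sₙ` is trivial, the trivialisation being
`(b, x) ↦ Σ xᵢ sᵢ(b)` (a continuous fibrewise isomorphism, whose inverse is continuous by Lemma 2.3).
The tree's `ComplexVectorBundle.nonempty_iso_trivial_of_frame` (`FramedBundleTrivial.lean`) proves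
exactly this but only records `Nonempty (Iso)`; consumers that GLUE local trivialisations (e.g. the
comparison of two analytifications of one algebraic vector bundle) need the FORMULA of the
isomorphism. This file re-runs that proof keeping the formula, and deduces that two bundles framed
over the same index set are isomorphic by an isomorphism carrying one frame to the other:

* `ComplexVectorBundle.exists_iso_trivial_of_frame` — `∃ e : B × ℂʳ ≅ E` with
  `e (x, c) = Σ cᵢ σᵢ(x)`;
* `ComplexVectorBundle.exists_iso_of_frames` — for frames `σ` of `E` and `σ'` of `E'` (same index
  set): `∃ e : E ≅ E'` with `e (σᵢ(x)) = σ'ᵢ(x)` for all `x`, `i`.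

Everything is proved; no definitions, no named facts.

## References

* J. Milnor, J. Stasheff, *Characteristic Classes*, Ann. of Math. Studies 76 (1974), §2 Thm. 2.2,
  Lemma 2.3. [MilnorStasheff1974]
* D. Husemoller, *Fibre Bundles*, 3rd ed., GTM 20 (1994), Ch. 3 §2, Ch. 5 §2. [HusemollerFibreBundles1994]
-/

noncomputable section

open Bundle Topology Set Function Filter Module

namespace Literature.AlgebraicTopology.CharacteristicClasses

namespace ComplexVectorBundle

universe u

variable {B : Type u} [TopologicalSpace B] {ι : Type} [Fintype ι]

/-- **A complex vector bundle with a continuous global frame is trivial, by the isomorphism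
`(x, c) ↦ Σ cᵢ σᵢ(x)`** (Milnor–Stasheff 1974, §2 Thm. 2.2 ff. with Lemma 2.3, complex version, with
the formula of the isomorphism recorded; the proof is that of `nonempty_iso_trivial_of_frame`).
[cite: MilnorStasheff1974, §2 Thm. 2.2 and Lemma 2.3] -/
theorem exists_iso_trivial_of_frame (E : ComplexVectorBundle.{u, 0} B)
    (σ : ι → (x : B) → E.E x)
    (hσc : ∀ i, Continuous fun x ↦ (⟨x, σ i x⟩ : TotalSpace E.F E.E))
    (hσb : ∀ x, LinearIndependent ℂ (fun i ↦ σ i x) ∧ ⊤ ≤ Submodule.span ℂ (range fun i ↦ σ i x)) :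
    ∃ e : (trivial B (ι → ℂ)).Iso E, ∀ (x : B) (c : ι → ℂ), e.equiv x c = ∑ i, c i • σ i x := by
  classical
  -- the trivialisations at the points of `B` and the induced bases of the model fibre
  let T : ∀ x : B, E.E x ≃L[ℂ] E.F := fun x ↦
    (trivializationAt E.F E.E x).continuousLinearEquivAt ℂ x (mem_baseSet_trivializationAt E.F E.E x)
  let bE : ∀ x : B, Basis ι ℂ (E.E x) := fun x ↦ Basis.mk (hσb x).1 (hσb x).2
  have hbE : ∀ x i, bE x i = σ i x := fun x i ↦ Basis.mk_apply (hσb x).1 (hσb x).2 i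
  let bF : ∀ x : B, Basis ι ℂ E.F := fun x ↦ (bE x).map (T x).toLinearEquiv
  -- the fibrewise equivalences `c ↦ Σ cᵢ σᵢ(x)`
  let eqv : ∀ x : B, (trivial B (ι → ℂ)).E x ≃L[ℂ] E.E x := fun x ↦
    ((bF x).equivFunL.symm).trans (T x).symm
  have heqv : ∀ x (c : ι → ℂ), eqv x c = ∑ i, c i • σ i x := by
    intro x c
    show (T x).symm ((bF x).equivFunL.symm c) = _
    have h1 : (bF x).equivFunL.symm c = ∑ i, c i • bF x i := by
      change (bF x).equivFun.symm c = _
      rw [Basis.equivFun_symm_apply]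
    rw [h1, map_sum]
    refine Finset.sum_congr rfl fun i _ ↦ ?_
    rw [map_smul]
    congr 1
    show (T x).symm ((T x).toLinearEquiv (bE x i)) = σ i x
    rw [← hbE x i]
    exact (T x).symm_apply_apply _
  -- continuity of a frame member read in a trivialisation
  have hread : ∀ (x₀ : B) (i : ι),
      ContinuousAt (fun x : B ↦ (trivializationAt E.F E.E x₀ ⟨x, σ i x⟩).2) x₀ := by
    intro x₀ i
    have h1 : ContinuousAt (trivializationAt E.F E.E x₀) ⟨x₀, σ i x₀⟩ :=
      (trivializationAt E.F E.E x₀).continuousAt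
        ((trivializationAt E.F E.E x₀).mem_source.2 (mem_baseSet_trivializationAt E.F E.E x₀))
    have h2 : ContinuousAt (fun x : B ↦ trivializationAt E.F E.E x₀ ⟨x, σ i x⟩) x₀ :=
      ContinuousAt.comp (f := fun x : B ↦ (⟨x, σ i x⟩ : TotalSpace E.F E.E)) h1 (hσc i).continuousAt
    exact h2.snd
  refine ⟨{ equiv := eqv, continuous_toFun := ?_, continuous_invFun := ?_ }, heqv⟩
  · -- `(x, c) ↦ Σ cᵢ σᵢ(x)` is continuous
    let g : B × (ι → ℂ) → TotalSpace E.F E.E := fun p ↦ ⟨p.1, ∑ i, p.2 i • σ i p.1⟩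
    have hg : Continuous g := by
      refine continuous_iff_continuousAt.2 fun p₀ ↦ ?_
      rw [FiberBundle.continuousAt_totalSpace]
      refine ⟨continuous_fst.continuousAt, ?_⟩
      -- in the trivialisation at `p₀.1` the second component is `Σ cᵢ (e₀ σᵢ(x))₂`
      have hsum : ContinuousAt (fun p : B × (ι → ℂ) ↦
          ∑ i, p.2 i • (trivializationAt E.F E.E p₀.1 ⟨p.1, σ i p.1⟩).2) p₀ :=
        tendsto_finsetSum _ fun i _ ↦
          ((continuous_apply i).continuousAt.comp continuousAt_snd).smul
            ((hread p₀.1 i).comp continuousAt_fst)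
      refine hsum.congr ?_
      have hopen : IsOpen (Prod.fst ⁻¹' (trivializationAt E.F E.E p₀.1).baseSet : Set (B × (ι → ℂ))) :=
        (trivializationAt E.F E.E p₀.1).open_baseSet.preimage continuous_fst
      filter_upwards [hopen.mem_nhds (mem_baseSet_trivializationAt E.F E.E p₀.1)] with p hp
      exact (trivialization_snd_sum_smul E _ hp σ p.2).symm
    have key : ∀ p : TotalSpace (ι → ℂ) (Bundle.Trivial B (ι → ℂ)),
        (⟨p.proj, eqv p.proj p.snd⟩ : TotalSpace E.F E.E) =
          g (Bundle.Trivial.homeomorphProd B (ι → ℂ) p) :=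
      fun p ↦ congrArg (TotalSpace.mk p.proj) (heqv p.proj p.snd)
    exact (continuous_congr key).2 (hg.comp (Bundle.Trivial.homeomorphProd B (ι → ℂ)).continuous)
  · -- the inverse `v ↦ (coordinates of v in the frame)` is continuous
    suffices h : Continuous fun p : TotalSpace E.F E.E ↦ (p.proj, ((eqv p.proj).symm p.snd : ι → ℂ)) by
      exact (Bundle.Trivial.homeomorphProd B (ι → ℂ)).symm.continuous.comp h
    refine continuous_iff_continuousAt.2 fun p₀ ↦ ?_
    refine (FiberBundle.continuous_proj E.F E.E).continuousAt.prodMk ?_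
    set x₀ := p₀.proj with hx₀
    set e₀ := trivializationAt E.F E.E x₀ with he₀
    -- a fixed identification of the model fibre with `ℂʳ`
    let Φ : E.F ≃L[ℂ] (ι → ℂ) := (bF x₀).equivFunL
    -- the frame in the trivialisation `e₀`, as a continuous family of linear maps `ℂʳ → F`
    let A : B → (ι → ℂ) →L[ℂ] E.F := fun x ↦
      ∑ i, ContinuousLinearMap.smulRightL ℂ (ι → ℂ) E.F
        (ContinuousLinearMap.proj i : (ι → ℂ) →L[ℂ] ℂ) ((e₀ ⟨x, σ i x⟩).2)
    have hA : ∀ x (c : ι → ℂ), A x c = ∑ i, c i • (e₀ ⟨x, σ i x⟩).2 := by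
      intro x c
      simp [A]
    have hAc : ContinuousAt A x₀ :=
      tendsto_finsetSum _ fun i _ ↦
        (ContinuousLinearMap.smulRightL ℂ (ι → ℂ) E.F
          (ContinuousLinearMap.proj i : (ι → ℂ) →L[ℂ] ℂ)).continuous.continuousAt.comp (hread x₀ i)
    -- over the base set of `e₀`, `Φ ∘ A x` is the invertible map `Φ ∘ e₀|ₓ ∘ eqv x`
    let U : ∀ x : B, x ∈ e₀.baseSet → ((ι → ℂ) ≃L[ℂ] (ι → ℂ)) := fun x hx ↦
      ((eqv x).trans (e₀.continuousLinearEquivAt ℂ x hx)).trans Φ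
    have hU : ∀ x (hx : x ∈ e₀.baseSet),
        ((U x hx : (ι → ℂ) ≃L[ℂ] (ι → ℂ)) : (ι → ℂ) →L[ℂ] (ι → ℂ)) =
          (Φ : E.F →L[ℂ] (ι → ℂ)).comp (A x) := by
      intro x hx
      ext c i
      have h1 : (U x hx) c = Φ ((e₀ ⟨x, eqv x c⟩).2) := rfl
      rw [ContinuousLinearMap.coe_comp, ContinuousLinearEquiv.coe_coe, ContinuousLinearEquiv.coe_coe,
        comp_apply, h1, heqv, hA, trivialization_snd_sum_smul E e₀ hx σ c]
    have hsymm : ∀ x (hx : x ∈ e₀.baseSet) (v : E.E x),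
        ((eqv x).symm v : ι → ℂ) = (U x hx).symm (Φ (e₀ ⟨x, v⟩).2) := by
      intro x hx v
      apply (U x hx).injective
      rw [ContinuousLinearEquiv.apply_symm_apply]
      show Φ ((e₀ ⟨x, eqv x ((eqv x).symm v)⟩).2) = Φ (e₀ ⟨x, v⟩).2
      rw [ContinuousLinearEquiv.apply_symm_apply]
    -- continuity of `x ↦ (U x)⁻¹` at `x₀` through `Ring.inverse`
    have hinv : ContinuousAt (fun x ↦ Ring.inverse ((Φ : E.F →L[ℂ] (ι → ℂ)).comp (A x))) x₀ := by
      have h1 : ContinuousAt (fun x ↦ (Φ : E.F →L[ℂ] (ι → ℂ)).comp (A x)) x₀ :=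
        ContinuousAt.clm_comp continuousAt_const hAc
      have h2 : ContinuousAt Ring.inverse ((Φ : E.F →L[ℂ] (ι → ℂ)).comp (A x₀)) := by
        rw [← hU x₀ (mem_baseSet_trivializationAt E.F E.E x₀)]
        exact NormedRing.inverse_continuousAt (ContinuousLinearEquiv.toUnit (U x₀ _))
      exact ContinuousAt.comp (f := fun x ↦ (Φ : E.F →L[ℂ] (ι → ℂ)).comp (A x)) (x := x₀) h2 h1
    have hcoord : ContinuousAt
        (fun p : TotalSpace E.F E.E ↦ Ring.inverse ((Φ : E.F →L[ℂ] (ι → ℂ)).comp (A p.proj))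
          (Φ (e₀ p).2)) p₀ := by
      refine ContinuousAt.clm_apply
        (ContinuousAt.comp (f := (TotalSpace.proj : TotalSpace E.F E.E → B)) (x := p₀) hinv
          (FiberBundle.continuous_proj E.F E.E).continuousAt) ?_
      have h1 : ContinuousAt e₀ p₀ :=
        e₀.continuousAt (e₀.mem_source.2 (mem_baseSet_trivializationAt E.F E.E x₀))
      exact Φ.continuous.continuousAt.comp h1.snd
    refine hcoord.congr ?_
    have hopen : IsOpen (TotalSpace.proj ⁻¹' e₀.baseSet : Set (TotalSpace E.F E.E)) :=
      e₀.open_baseSet.preimage (FiberBundle.continuous_proj E.F E.E)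
    filter_upwards [hopen.mem_nhds (mem_baseSet_trivializationAt E.F E.E x₀)] with p hp
    rw [hsymm p.proj hp p.snd, ← hU p.proj hp,
      show ((U p.proj hp : (ι → ℂ) ≃L[ℂ] (ι → ℂ)) : (ι → ℂ) →L[ℂ] (ι → ℂ)) =
        ((ContinuousLinearEquiv.toUnit (U p.proj hp) : ((ι → ℂ) →L[ℂ] (ι → ℂ))ˣ) :
          (ι → ℂ) →L[ℂ] (ι → ℂ)) from rfl,
      Ring.inverse_unit]
    rfl

/-- The `i`-th coordinate vector goes to the `i`-th frame member: `Σⱼ δᵢⱼ σⱼ(x) = σᵢ(x)`. [cite: MilnorStasheff1974, §2 Thm. 2.2] -/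
theorem sum_pi_single_smul [DecidableEq ι] (E : ComplexVectorBundle.{u, 0} B) (σ : ι → (x : B) → E.E x)
    (x : B) (i : ι) : ∑ j, (Pi.single i (1 : ℂ) : ι → ℂ) j • σ j x = σ i x := by
  rw [Finset.sum_eq_single i (fun j _ hj ↦ by rw [Pi.single_eq_of_ne hj, zero_smul]) (fun h ↦ (h (Finset.mem_univ i)).elim),
    Pi.single_eq_same, one_smul]

/-- **Two framed bundles are isomorphic by an isomorphism matching the frames**: if `σ₁, …, σ_r` and
`σ'₁, …, σ'_r` are continuous global frames of `E` and `E'` (same index set), there is a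
`B`-isomorphism `e : E ≅ E'` with `e(σᵢ(x)) = σ'ᵢ(x)` — compose the trivialisations
`B × ℂʳ ≅ E`, `B × ℂʳ ≅ E'` of Milnor–Stasheff Thm. 2.2. [cite: MilnorStasheff1974, §2 Thm. 2.2 and Lemma 2.3] -/
theorem exists_iso_of_frames (E E' : ComplexVectorBundle.{u, 0} B)
    (σ : ι → (x : B) → E.E x) (σ' : ι → (x : B) → E'.E x)
    (hσc : ∀ i, Continuous fun x ↦ (⟨x, σ i x⟩ : TotalSpace E.F E.E))
    (hσb : ∀ x, LinearIndependent ℂ (fun i ↦ σ i x) ∧ ⊤ ≤ Submodule.span ℂ (range fun i ↦ σ i x))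
    (hσ'c : ∀ i, Continuous fun x ↦ (⟨x, σ' i x⟩ : TotalSpace E'.F E'.E))
    (hσ'b : ∀ x, LinearIndependent ℂ (fun i ↦ σ' i x) ∧ ⊤ ≤ Submodule.span ℂ (range fun i ↦ σ' i x)) :
    ∃ e : E.Iso E', ∀ (x : B) (i : ι), e.equiv x (σ i x) = σ' i x := by
  classical
  obtain ⟨e₁, he₁⟩ := exists_iso_trivial_of_frame E σ hσc hσb
  obtain ⟨e₂, he₂⟩ := exists_iso_trivial_of_frame E' σ' hσ'c hσ'b
  refine ⟨e₁.symm.trans e₂, fun x i ↦ ?_⟩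
  have h1 : e₁.equiv x (Pi.single i (1 : ℂ) : ι → ℂ) = σ i x := by rw [he₁, sum_pi_single_smul]
  have h2 : (e₁.equiv x).symm (σ i x) = (Pi.single i (1 : ℂ) : ι → ℂ) := by
    rw [← h1, ContinuousLinearEquiv.symm_apply_apply]
  change e₂.equiv x ((e₁.equiv x).symm (σ i x)) = σ' i x
  rw [h2, he₂, sum_pi_single_smul]

end ComplexVectorBundle

end Literature.AlgebraicTopology.CharacteristicClasses

end
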